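import Summits.QuantumFields.QCD.Theorems.PauliWegnerSeaChiralGluonicCompletionDefs
import Summits.QuantumFields.QCD.Theses.DiagonalSpine

/-!
# Stub `stub_latticeGap` of crux `ChiralGluonicCompletion` (stmt-QuantumFields-17498), line `Sketch` —
# calibration: the stub is blocked, and what it is blocked on (lead wave 1, worker verdict 2026-08-17)

The registered stub
`∀ Nf, Nf = 2 ∨ Nf = 3 → ∀ reg, Hyp Nf reg → ∀ m > 0, ∃ Δ > 0, (reg.scheme m 0 0).HasLatticeMassGap Δ`
is the signed, all-volume (`S ≥ L_k`), all-observable uniform lattice gap of the GIVEN chiral regularisation at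
every positive mass tuple.  No theorem of the tree concludes `QCDScheme.HasLatticeMassGap Δ` (`Δ > 0`) for a
`reg.scheme m 0 0` from hypotheses contained in `Hyp` (searched: `Summits/QuantumFields/QCD/Theorems`,
`Theses`, `Literature/MathematicalPhysics/QuantumFieldTheory/QCD*.lean`; the only PROVED `∀ reg` producer is
`CentreStabilisedCircle.SlabToTorus`, whose input `HasCircleClustering` is gluonic clustering not in `Hyp`).

The two bookkeeping lemmas below are machine-checked support for the verdict
`stub-blocked: DiagonalSpine.FullLatticeGap (stmt-QuantumFields-8928)`:
* `fullLatticeGap_of_stub` — on the crux's own hypothesis (`Hyp` inhabited for `N_f = 2, 3`) the stub PROVES the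
  open crux `DiagonalSpine.FullLatticeGap` (8928, "THE LATTICE HALF", open-problem): the stub is at least as hard.
* `hyp_inhabited_of_chiralMobilityGap` — `Hyp` is literally the body of `WilsonMobilityGap.ChiralMobilityGap`
  (stmt-QuantumFields-17497) conjoined per mass with the conclusion of `PhaseQuenchedFlavourDecay` (9151), so
  "Hyp inhabited" is `ChiralMobilityGap ∧ PhaseQuenchedFlavourDecay`-sized, not vacuous by bookkeeping.
-/

noncomputable section

namespace Summit.QuantumFields.QCD.Theorems.StronglyChiralSubsequence

open MeasureTheory Filter Topology
open Literature.MathematicalPhysics.QuantumFieldTheory Literature.MathematicalPhysics.QuantumLattice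
  Literature.Probability.LatticeModels

/-- **The stub, on an inhabited hypothesis, proves `DiagonalSpine.FullLatticeGap` (stmt-QuantumFields-8928).**
Given, for `N_f = 2, 3`, some regularisation carrying the crux's package `Hyp`, the stub's conclusion at every
positive tuple together with `HasMassScaling`, asymptotic scaling and clause (i) (the physical branch, which is
`FullLatticeGap`'s branch clause through `QCDRegularisation.scheme_mq`) is exactly the body of `FullLatticeGap`. -/
theorem fullLatticeGap_of_stub
    (hinh : ∀ Nf : ℕ, Nf = 2 ∨ Nf = 3 → ∃ reg : QCDRegularisation Nf, Hyp Nf reg)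
    (hstub : ∀ Nf : ℕ, Nf = 2 ∨ Nf = 3 → ∀ reg : QCDRegularisation Nf, Hyp Nf reg →
      ∀ m : Fin Nf → ℝ, (∀ f, 0 < m f) → ∃ Δ > 0, (reg.scheme m 0 0).HasLatticeMassGap Δ) :
    Summit.QuantumFields.QCD.Theses.DiagonalSpine.FullLatticeGap := by
  intro Nf hNf
  obtain ⟨reg, hH⟩ := hinh Nf hNf
  refine ⟨reg, hH.1, hH.2.2.1, fun m hm => ⟨fun f => ?_, hstub Nf hNf reg hH m hm⟩⟩
  simpa only [QCDRegularisation.scheme_mq] using (hH.2.2.2 m hm).1.1 f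

/-- **`Hyp` is the body of `ChiralMobilityGap` plus, per mass, the conclusion of `PhaseQuenchedFlavourDecay`.**
In particular `(∃ reg, Hyp N_f reg)` for `N_f = 2, 3` follows from `WilsonMobilityGap.ChiralMobilityGap`
(stmt-QuantumFields-17497) and `WilsonMobilityGap.PhaseQuenchedFlavourDecay` (stmt-QuantumFields-9151). -/
theorem hyp_inhabited_of_chiralMobilityGap : Summit.QuantumFields.QCD.Theses.WilsonMobilityGap.ChiralMobilityGap → Summit.QuantumFields.QCD.Theses.WilsonMobilityGap.PhaseQuenchedFlavourDecay → ∀ Nf : ℕ, Nf = 2 ∨ Nf = 3 → ∃ reg : QCDRegularisation Nf, Hyp Nf reg := by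
  intro hK1 hK2 Nf hNf
  obtain ⟨reg, hMS, hch, hAS, hm⟩ := hK1 Nf hNf
  refine ⟨reg, hMS, hch, hAS, fun m hmpos => ?_⟩
  obtain ⟨h1, h2, h3, h4⟩ := hm m hmpos
  exact ⟨⟨h1, h2, h3, h4⟩, hK2 Nf reg m hmpos h2⟩

/-- Hence the stub would close `FullLatticeGap` outright from `ChiralMobilityGap ∧ PhaseQuenchedFlavourDecay`. -/
theorem fullLatticeGap_of_stub'
    (hK1 : Summit.QuantumFields.QCD.Theses.WilsonMobilityGap.ChiralMobilityGap)
    (hK2 : Summit.QuantumFields.QCD.Theses.WilsonMobilityGap.PhaseQuenchedFlavourDecay)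
    (hstub : ∀ Nf : ℕ, Nf = 2 ∨ Nf = 3 → ∀ reg : QCDRegularisation Nf, Hyp Nf reg →
      ∀ m : Fin Nf → ℝ, (∀ f, 0 < m f) → ∃ Δ > 0, (reg.scheme m 0 0).HasLatticeMassGap Δ) :
    Summit.QuantumFields.QCD.Theses.DiagonalSpine.FullLatticeGap :=
  fullLatticeGap_of_stub (hyp_inhabited_of_chiralMobilityGap hK1 hK2) hstub

end Summit.QuantumFields.QCD.Theorems.StronglyChiralSubsequence

end
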